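/-
Copyright (c) 2026 the pub-hodgecm-mathlib formalisation cell (harness21).  Prover seat hodgecm-mathlib-K2Liu-p02 (g8), Track B «K2-LIT» ∕ hLiu418
#184♮, Road I v3, unit U5 «THE CLOSE» STEP C — the #42F′ TOP, EDITION 7 «THE HOL-CUT SPLIT» (RULINGS M-158l (c) ∕ M-158n ∕ M-158o: FACE-A + FACE-G + FACE-D₀ over ★ ED. 1).
-/
import Summits.HodgeConjecture.HodgeConjecture.Theorems.K2LiuFirstTermIdentityFaceDefs          -- ED. 7 predicates of record: `HolCutPred`, `AdmissibleOn`, `ThetaValuedOn`, `RigidityRowsOn`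
import Summits.HodgeConjecture.HodgeConjecture.Theorems.K2LiuRankOneRigidityDegenerate          -- ★ p862421: `rankOneRigidity_of_eq_smul_split` — U2 WITHOUT `hne`
import Summits.HodgeConjecture.HodgeConjecture.Theorems.K2LiuDoubledLiftSpanReduction           -- ★ `doubledLineThetaLift_smul`
import Summits.HodgeConjecture.HodgeConjecture.Theorems.K2LiuLineThetaSideWitness               -- ★ p858449: a theta datum on any line (anisotropic branch, `⟨1⟩`)
import Summits.HodgeConjecture.HodgeConjecture.Theorems.K2LiuWittLineEmbedding                   -- ★ p861452: `exists_lineFrame`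
import HarnessLib

/-!
# K2_Liu road (hLiu418), Road I v3, U5 «THE CLOSE» STEP C: THE #42F′ TOP — EDITION 7 «THE HOL-CUT SPLIT»
# `∀ HL, ‹#41› → ‹FACE-A› → ‹FACE-G HL› → ‹FACE-D₀ HL› → ‹#42F′ :711 verbatim›`

Cell `pub/hodgecm-mathlib` (D-0151), Track B, build stream 29.  ★ ED. 6 `K2LiuFirstTermIdentityAssemblyDatumPrime` (p862586) asks ★ U2's rigidity rows on EVERY
finite-dimensional `K_∞`-stable `V`; SIGS §1 (R-gen) ∕ RULING M-158l (c) pays general `K_∞`-types from the SCALAR (holomorphic) line instead (G1 + (A-int)-arch + G2 (d)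
+ U1-arch + 𝔤-equivariance of `B`).  THIS EDITION splits FACE-D′ along a HOL-CUT PREDICATE `HL : HolCutPred` (a PARAMETER of the head; the split is sound for EVERY
`HL` and its two payers instantiate `HL := HL_rec`, «`V = ℂ • E_∞(v_G)`», jointly at the tie) into
* **FACE-D₀ HL** — ★ ED. 6's FACE-D′ with ONE inserted antecedent `HL … V →`: isotropic `V′`, every line of record `a′` (frame equation + discriminant clause of ★
  `exists_lineFrame` by value), the PAYER's theta datum `(hρ, μW, fw)` (finite, invariant), and on every HOL-CUT rigidity domain with admissible `T₁`
  (`AdmissibleOn`, ★ 0c's (a)(b)(c)) the rows `RigidityRowsOn` (★ U2's inputs, `hne`-free packaging of ★ `K2LiuRankOneRigidityDegenerate`);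
* **FACE-G HL** («(R-gen)», ONE composite row in FACE-R's currency, uniform in the datum): isotropic `V′`, every line of record, EVERY finite invariant datum, every
  rigidity domain with admissible `T₁`: if on the hol-cut domains every admissible `T₁₀` is `ThetaValuedOn` (values in `im B_{fw}`), then so is `T₁`;
and keeps **FACE-A** («U1-aniso»: anisotropic `V′` ⇒ every admissible residue map vanishes; Weil's convergent range [GanQiuTakeda2014, §7.1 Thm. 18; Ichino2007]).
The predicates are the open predicates of record of `K2LiuFirstTermIdentityFaceDefs` (bodies = ★ ED. 6 bytes; RULING M-158o (a)).  Proof: ★ ED. 1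
`firstTermIdentityOnGenerators_of_rigidityFace` after FACE-R by cases on isotropy — anisotropic: `a′ := 1`, ★ `exists_lineThetaSide_witness` on `⟨1⟩`, `T₁ = 0` by
FACE-A, `Φ′ := 0` (★ `doubledLineThetaLift_smul`); isotropic: `a′` from ★ `exists_lineFrame`, the datum from FACE-D₀, then FACE-G at that datum, its hol-cut hypothesis
discharged by FACE-D₀'s rows + ★ `rankOneRigidity_of_eq_smul_split` (`Φ′ := c • 𝓣 x₀`).  INTERPOLATION (honesty check): `HL := fun … => True` gives ★ ED. 6, `HL :=
fun … => False` makes FACE-G FALSE (universal datum: at `μW := 0` it would force every residue to vanish — K2E5-r02 box, RULING M-158p (2)); the rule of record: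
FACE-G^{HL} is true iff every datum whose `range B_{fw}` misses the residue's line is caught by an `HL`-domain with a non-zero admissible residue, so `HL_rec` must
admit the Gaussian line; between «Gaussian line ⊆ HL» and `True` the edition interpolates ED. 6.  DEGENERATE INSTANCES (σ23): `V = ⊥` ⇒ `D_⊥ = 0`: FACE-G needs
`B_{fw} 0 = 0`, FACE-D₀ the zero witnesses (`𝓣 := 0, T₂ := 0, P := ⊥, coeff := 0, R := S := 0, c₁ := 0`); anisotropic `V′` ⇒ FACE-G∕D₀ vacuous (no adelic Witt frame).
σ24: datum existential in FACE-D₀ (the payer names the weight of record — (w) EQUAL 2026-09-04), universal in FACE-G.  Nothing here closes #41 or #42F′.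
No definition, no instance, no notation, no named-fact hypothesis (the three predicates are open predicates applied to bound data), no `sorry`; axioms ⊆ {propext,
Classical.choice, Quot.sound}.  HONEST LABEL: HC_CM is proved only modulo the 7 printed citations (2 remaining named inputs: hLiu418 = stmt-HodgeConjecture-24832, h413 = stmt-HodgeConjecture-24833) until rung 0 closes; `--supports stmt-HodgeConjecture-24832 --as helper` helper, moves no counter.
References: [GanQiuTakeda2014] Invent. Math. 198 (2014) §2.6–2.8, §3.2, §3.6, §7.1 Thm. 18, §7.2 Thm. 20 (i); [Ichino2007] Math. Z. 255 (2007) 721–729; [KudlaRallis1994]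
Ann. of Math. 140 (1994) §1 Thm. 1.1, §3; [Liu2021] Camb. J. Math. 9 (2021) App. B Lem. B.9–B.12, proof of Prop. B.8 pp. 103–106.
-/

set_option autoImplicit false
set_option linter.dupNamespace false

noncomputable section
open scoped Matrix Topology TensorProduct SchwartzMap Classical  -- `Classical`: the `Fintype` of real ∕ complex places inside `mixedSpace (L⁺)` (as in ★ U2f)
open NumberField NumberField.mixedEmbedding IsDedekindDomain MeasureTheory Filter
open Literature.NumberTheory.Automorphic Literature.NumberTheory.Automorphic.UnitaryGroup Literature.NumberTheory.GaloisRepresentations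
open Literature.NumberTheory.GelbartRogawski1991 Literature.NumberTheory.GelbartRogawski1991.GRConstruction
open Literature.NumberTheory.GelbartRogawski1991.UnitaryDualPair
open Literature.NumberTheory.K2Lit.SiegelDoubled Literature.NumberTheory.K2Lit.DoubledLineTheta
open Literature.NumberTheory.Automorphic.IdeleClassGroup
open Literature.NumberTheory.Automorphic.Liu2021
open Literature.NumberTheory.Automorphic.Liu2021.Def411WeilCarriers
open Literature.NumberTheory.Automorphic.Liu2021.Def411WeilCarriersDoubling
open Literature.NumberTheory.Weil1964
open Literature.RepresentationTheory.Liu2021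
open Literature.RepresentationTheory.HarrisKudlaSweet1996 (IsSplittingChar)
open Summit.HodgeConjecture.HodgeConjecture.Cruxes.HLiu418.K2LiuFirstTermResidueFormDefs (resNorm)
open Summit.HodgeConjecture.HodgeConjecture.Cruxes.HLiu418.K2LiuFirstTermIdentityAssembly (firstTermIdentityOnGenerators_of_rigidityFace)
open Summit.HodgeConjecture.HodgeConjecture.Cruxes.HLiu418.K2LiuRankOneRigidityDegenerate (rankOneRigidity_of_eq_smul_split)
open Summit.HodgeConjecture.HodgeConjecture.Cruxes.HLiu418.K2LiuDoubledLiftSpanReduction (doubledLineThetaLift_smul)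
open Summit.HodgeConjecture.HodgeConjecture.Cruxes.HLiu418.K2LiuLineThetaSideWitness (exists_lineThetaSide_witness)
open Summit.HodgeConjecture.HodgeConjecture.Cruxes.HLiu418.K2LiuWittLineEmbedding (exists_lineFrame)
open Summit.HodgeConjecture.HodgeConjecture.Cruxes.HLiu418.K2LiuFirstTermIdentityFaceDefs

namespace Summit.HodgeConjecture.HodgeConjecture.Cruxes.HLiu418.K2LiuFirstTermIdentityAssemblyHolCut

set_option maxHeartbeats 4000000 in -- #41 + #42F′ by value + three faces; ED. 3–6 measured: the socket telescope times out at 2400000 on the STATEMENT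
/-- **U5 STEP C, EDITION 7 — THE #42F′ TOP SPLIT ALONG THE HOL CUT: `∀ HL, ‹#41› → ‹FACE-A› → ‹FACE-G HL› → ‹FACE-D₀ HL› → ‹#42F′›`.**  Conclusion =
`sig_K2LiuFirstTermIdentityOnGenerators` (U6 ED. 12 :711–771) BY VALUE, bytes verbatim; hypotheses = a hol-cut predicate `HL` (parameter), socket #41 (:289) BY
VALUE, FACE-A (anisotropic `V′`: admissible residue maps vanish), FACE-G `HL` ((R-gen): residue maps on every `D_V` are `B_{fw}`-valued once those on the hol-cut
domains are) and FACE-D₀ `HL` (existential theta datum; ★ U2's `hne`-free rows on the hol-cut domains) — through the open predicates `AdmissibleOn`,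
`ThetaValuedOn`, `RigidityRowsOn` of record.  A theorem for every `HL` (`True` ⇒ ★ ED. 6; FACE-G is payable only for `HL` admitting the Gaussian line,
RULING M-158p (2)).  Proof: ★ ED. 1 after FACE-R (module docstring).
Nothing here closes #41 or #42F′.
[cite: GanQiuTakeda2014, §3.2, §7.1 Thm. 18, §7.2 Thm. 20 (i)] [cite: Ichino2007] [cite: KudlaRallis1994, §1 Thm. 1.1, §3] [cite: Liu2021, App. B Lem. B.9–B.12, proof of Prop. B.8 pp. 103–106] -/
theorem firstTermIdentityOnGenerators_of_holCut (HL : HolCutPred)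
    (h41 : ∀ (L : Type) [Field L] [NumberField L] [IsCMField L] {n : ℕ} (e : Fin 2 × Fin 1 ≃ Fin n)
      (dV : Fin 2 → L) (hdV : ∀ i, IsCMField.complexConj L (dV i) = dV i) (hdV0 : ∀ i, dV i ≠ 0)
      (dW : Fin 1 → L) (hdW : ∀ i, IsCMField.complexConj L (dW i) = dW i) (hdW0 : ∀ i, dW i ≠ 0)
      (lam : Literature.NumberTheory.Automorphic.IdeleClassGroup L →ₜ* Circle) (hlam : IsConjugateSymplectic L lam),
      HasWeight L lam 1 →
      ∀ (𝒦 : IwasawaDatum L e dV hdV dW hdW) (_h𝒦 : 𝒦.IsStd) (f : ℂ → HA L e dV hdV dW hdW → ℂ),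
        IsStandardSectionFamily 𝒦 (toHeckeCharacter L lam⁻¹) f → (∀ s, Continuous (f s)) →
      ∃ (P : Finset ℂ) (Es : ℂ → HA L e dV hdV dW hdW → ℂ),
        (∀ h : HA L e dV hdV dW hdW, DifferentiableOn ℂ (fun s => Es s h) {s : ℂ | 0 < s.re}) ∧
        (∀ s : ℂ, 0 < s.re → Continuous (Es s)) ∧
        (∀ s : ℂ, 0 < s.re → ∀ (γ : ratH L e dV hdV dW hdW) (h : HA L e dV hdV dW hdW),
          Es s ((γ : HA L e dV hdV dW hdW) * h) = Es s h) ∧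
        (∀ (s : ℂ) (h : HA L e dV hdV dW hdW), (n : ℝ) / 2 < s.re →
          Es s h = (∏ p ∈ P, (s - p)) * eisensteinFamilyDelta L e dV hdV dW hdW f s h) ∧
        (∀ z : ℂ, 0 < z.re → ∃ C A r : ℝ, 0 < r ∧ ∀ s : ℂ, dist s z < r → ∀ h : HA L e dV hdV dW hdW,
          ‖Es s h‖ ≤ C * adelicHeightGL (n + n) L (h : GL (Fin (n + n)) (AdeleRing (𝓞 L) L)) ^ A))
    (hA : ∀ (L : Type) [Field L] [NumberField L] [IsCMField L] {n : ℕ} (e : Fin 2 × Fin 1 ≃ Fin n)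
      (dV : Fin 2 → L) (hdV : ∀ i, IsCMField.complexConj L (dV i) = dV i) (hdV0 : ∀ i, dV i ≠ 0)
      (dW : Fin 1 → L) (hdW : ∀ i, IsCMField.complexConj L (dW i) = dW i) (hdW0 : ∀ i, dW i ≠ 0)
      (lam : Literature.NumberTheory.Automorphic.IdeleClassGroup L →ₜ* Circle) (hlam : IsConjugateSymplectic L lam),
      HasWeight L lam 1 →
      ∀ {M' n' : ℕ} (eW : Fin 1 × Fin 3 ≃ Fin M') (e' : Fin 2 × Fin M' ≃ Fin n')
        (dV' : Fin 3 → L) (hdV' : ∀ k, IsCMField.complexConj L (dV' k) = dV' k) (hdV'0 : ∀ k, dV' k ≠ 0)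
        (χb : HeckeCharacter L) (hχbu : χb.IsUnitary) (hχbs : Literature.RepresentationTheory.HarrisKudlaSweet1996.IsSplittingChar L 1 χb)
        (α : UnitaryGroup.adelicOne (Fp L) L (IsCMField.complexConj L) →* ℂˣ) (hα : Continuous α)
        (hαrat : ∀ u : UnitaryGroup.adelicOne (Fp L) L (IsCMField.complexConj L),
          (u : Literature.NumberTheory.GaloisRepresentations.ideleGroup L) ∈ Literature.NumberTheory.GaloisRepresentations.principalIdeles L → α u = 1)
        (_hχD : χb ^ 3 * DoubledWeilDetTwist.ratioHecke L α hα hαrat = toHeckeCharacter L lam⁻¹)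
        (𝒦 : IwasawaDatum L e dV hdV dW hdW) (_h𝒦 : 𝒦.IsStd),
        -- FACE-A («U1-aniso»): for an ANISOTROPIC `V′` (Weil's convergent range, [GQT14 Thm. 18]: `E(s, g_x)` is holomorphic at `s₀ = ½`) the residue map of ★ 0c VANISHES on every `D_V`
        (¬ ∃ v : Fin 3 → L, v ≠ 0 ∧ ∑ k, dV' k * (v k * IsCMField.complexConj L (v k)) = 0) →
        ∀ (V : Submodule ℂ 𝓢(((Fin (n' + n')) → mixedSpace (Fp L)), ℂ)), FiniteDimensional ℂ V →
          (∀ ainf : UnitaryGroup.arch (Fp L) L (IsCMField.complexConj L) (n + n) (hermD L e dV hdV dW hdW),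
            (UnitaryGroup.archToAdelic (Fp L) L (IsCMField.complexConj L) (n + n) (hermD L e dV hdV dW hdW) ainf : HA L e dV hdV dW hdW) ∈ 𝒦.K →
            ∀ a ∈ V, ∃ a'' ∈ V, ∀ f : FinSB (Fp L) (Fin (n' + n')),
              adelicMpCont.omega (Fp L) (Fin (n' + n')) (gramDA L e' dV hdV (tensorFrame L dW eW dV') (tensorFrame_real L dW hdW eW dV' hdV'))
                  ((doubledWeilRep L e' dV hdV hdV0 (tensorFrame L dW eW dV') (tensorFrame_real L dW hdW eW dV' hdV')
                        (tensorFrame_ne_zero L dW eW dV' hdW0 hdV'0) χb hχbu hχbs)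
                    (tensorEmb L e dV hdV dW hdW eW e' dV' hdV'
                      (UnitaryGroup.archToAdelic (Fp L) L (IsCMField.complexConj L) (n + n) (hermD L e dV hdV dW hdW) ainf)))
                  (piSchwartzBruhatEquiv (Fp L) (Fin (n' + n')) (a ⊗ₜ[ℂ] f)) =
                piSchwartzBruhatEquiv (Fp L) (Fin (n' + n')) (a'' ⊗ₜ[ℂ] f)) →
          ∀ (T₁ : ↥(Submodule.span ℂ {x : piSchwartzBruhat (Fp L) (Fin (n' + n')) |
              ∃ a ∈ V, ∃ f : FinSB (Fp L) (Fin (n' + n')), x = piSchwartzBruhatEquiv (Fp L) (Fin (n' + n')) (a ⊗ₜ[ℂ] f)}) →ₗ[ℂ]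
              (HA L e dV hdV dW hdW → ℂ)),
            AdmissibleOn L e dV hdV hdV0 dW hdW hdW0 eW e' dV' hdV' hdV'0 χb hχbu hχbs α 𝒦 V T₁ → ∀ x, T₁ x = 0)
    (hG : ∀ (L : Type) [Field L] [NumberField L] [IsCMField L] {n : ℕ} (e : Fin 2 × Fin 1 ≃ Fin n)
      (dV : Fin 2 → L) (hdV : ∀ i, IsCMField.complexConj L (dV i) = dV i) (hdV0 : ∀ i, dV i ≠ 0)
      (dW : Fin 1 → L) (hdW : ∀ i, IsCMField.complexConj L (dW i) = dW i) (hdW0 : ∀ i, dW i ≠ 0)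
      (lam : Literature.NumberTheory.Automorphic.IdeleClassGroup L →ₜ* Circle) (hlam : IsConjugateSymplectic L lam),
      HasWeight L lam 1 →
      ∀ {M' n' : ℕ} (eW : Fin 1 × Fin 3 ≃ Fin M') (e' : Fin 2 × Fin M' ≃ Fin n')
        (dV' : Fin 3 → L) (hdV' : ∀ k, IsCMField.complexConj L (dV' k) = dV' k) (hdV'0 : ∀ k, dV' k ≠ 0)
        (χb : HeckeCharacter L) (hχbu : χb.IsUnitary) (hχbs : Literature.RepresentationTheory.HarrisKudlaSweet1996.IsSplittingChar L 1 χb)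
        (α : UnitaryGroup.adelicOne (Fp L) L (IsCMField.complexConj L) →* ℂˣ) (hα : Continuous α)
        (hαrat : ∀ u : UnitaryGroup.adelicOne (Fp L) L (IsCMField.complexConj L),
          (u : Literature.NumberTheory.GaloisRepresentations.ideleGroup L) ∈ Literature.NumberTheory.GaloisRepresentations.principalIdeles L → α u = 1)
        (_hχD : χb ^ 3 * DoubledWeilDetTwist.ratioHecke L α hα hαrat = toHeckeCharacter L lam⁻¹)
        (𝒦 : IwasawaDatum L e dV hdV dW hdW) (_h𝒦 : 𝒦.IsStd)
      {n'' : ℕ} (e₁ : Fin (n + n) × Fin 1 ≃ Fin n''),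
      -- FACE-G («(R-gen)», ED. 7): for an ISOTROPIC `V′` and every line of record `a′` (★ `exists_lineFrame`'s frame `T` and discriminant clause BY VALUE) …
      ∀ (a' : (↥(maximalRealSubfield L))ˣ) (T : GL (Fin 3) (AdeleRing (𝓞 L) L)),
        formCongr (conjAdele (Fp L) L (IsCMField.complexConj L)) T (adelicForm L 3 (Matrix.diagonal dV')) =
          adelicForm L (1 + 2) (finSum 1 2 (JW (Fp L) L a') !![0, 1; 1, 0]) →
        -((a' : Fp L) : L) ∈ (Set.range fun A : Matrix (Fin 3) (Fin 3) L =>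
          (A.map (IsCMField.complexConj L : L →+* L)).det * (∏ k, dV' k) * A.det) →
        -- … and EVERY theta datum `(hρ, μW, fw)` on `⟨a′⟩` (finite, `U(⟨a′⟩)(𝔸)`-invariant) — uniformly: only linearity ∕ equivariance of `B_{fw}` are at stake …
        ∀ (hρ : HasThetaMajorants fun
          (p : ↥(UnitaryGroup.adelic (↥(maximalRealSubfield L)) L (IsCMField.complexConj L) (n + n) (Matrix.diagonal (dD L e dV hdV dW hdW))) ×
            ↥(UnitaryGroup.adelic (↥(maximalRealSubfield L)) L (IsCMField.complexConj L) 1 (JW (↥(maximalRealSubfield L)) L a')))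
          (Ψ : piSchwartzBruhat (↥(maximalRealSubfield L)) (Fin n'')) =>
            pairRep (↥(maximalRealSubfield L)) L (IsCMField.complexConj L) (n + n) 1 e₁ (Matrix.diagonal (dD L e dV hdV dW hdW)) (JW (↥(maximalRealSubfield L)) L a')
              (chiSplittingLine L e₁ (dD L e dV hdV dW hdW) (dD_conj L e dV hdV dW hdW) (dD_ne_zero L e dV hdV dW hdW hdV0 hdW0)
                (toHeckeCharacter L lam⁻¹) (isUnitary_toHeckeCharacter L lam⁻¹)
                ((isOscillatorChar_toHeckeCharacter_iff lam⁻¹).mpr (K2LiuConjugateSymplecticInv.IsConjugateSymplectic.inv hlam)) (TW (↥(maximalRealSubfield L)) a')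
                (isUnit_det_TW (↥(maximalRealSubfield L)) a') (JW (↥(maximalRealSubfield L)) L a') (JW_eq (↥(maximalRealSubfield L)) L a'))
              p Ψ)
        (μW : @Measure (↥(UnitaryGroup.adelic (↥(maximalRealSubfield L)) L (IsCMField.complexConj L) 1 (JW (↥(maximalRealSubfield L)) L a')) ⧸
          (UnitaryGroup.toAdelic (↥(maximalRealSubfield L)) L (IsCMField.complexConj L) 1 (JW (↥(maximalRealSubfield L)) L a')).range) (borel _))
        (fw : C(↥(UnitaryGroup.adelic (↥(maximalRealSubfield L)) L (IsCMField.complexConj L) 1 (JW (↥(maximalRealSubfield L)) L a')) ⧸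
          (UnitaryGroup.toAdelic (↥(maximalRealSubfield L)) L (IsCMField.complexConj L) 1 (JW (↥(maximalRealSubfield L)) L a')).range, ℂ)),
        @IsFiniteMeasure _ (borel _) μW →
        @SMulInvariantMeasure
          ↥(UnitaryGroup.adelic (↥(maximalRealSubfield L)) L (IsCMField.complexConj L) 1 (JW (↥(maximalRealSubfield L)) L a'))
          (↥(UnitaryGroup.adelic (↥(maximalRealSubfield L)) L (IsCMField.complexConj L) 1 (JW (↥(maximalRealSubfield L)) L a')) ⧸
            (UnitaryGroup.toAdelic (↥(maximalRealSubfield L)) L (IsCMField.complexConj L) 1 (JW (↥(maximalRealSubfield L)) L a')).range)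
          _ (borel _) μW →
        -- … on EVERY rigidity domain `D_V` with an admissible `T₁` (★ 0c): IF on the HOL-CUT domains `V₀` (predicate `HL`) every admissible `T₁₀` is
        -- `B_{fw}`-valued, THEN so is `T₁` (SIGS §1 (R-gen): `R₂(V′_σ)^{K-fin} = U(𝔤_σ)·v + ker M*_σ(½)`, G1, U1-arch, 𝔤-equivariance + linearity of `B`)
        ∀ (V : Submodule ℂ 𝓢(((Fin (n' + n')) → mixedSpace (Fp L)), ℂ)), FiniteDimensional ℂ V →
          (∀ ainf : UnitaryGroup.arch (Fp L) L (IsCMField.complexConj L) (n + n) (hermD L e dV hdV dW hdW),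
            (UnitaryGroup.archToAdelic (Fp L) L (IsCMField.complexConj L) (n + n) (hermD L e dV hdV dW hdW) ainf : HA L e dV hdV dW hdW) ∈ 𝒦.K →
            ∀ a ∈ V, ∃ a'' ∈ V, ∀ f : FinSB (Fp L) (Fin (n' + n')),
              adelicMpCont.omega (Fp L) (Fin (n' + n')) (gramDA L e' dV hdV (tensorFrame L dW eW dV') (tensorFrame_real L dW hdW eW dV' hdV'))
                  ((doubledWeilRep L e' dV hdV hdV0 (tensorFrame L dW eW dV') (tensorFrame_real L dW hdW eW dV' hdV')
                        (tensorFrame_ne_zero L dW eW dV' hdW0 hdV'0) χb hχbu hχbs)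
                    (tensorEmb L e dV hdV dW hdW eW e' dV' hdV'
                      (UnitaryGroup.archToAdelic (Fp L) L (IsCMField.complexConj L) (n + n) (hermD L e dV hdV dW hdW) ainf)))
                  (piSchwartzBruhatEquiv (Fp L) (Fin (n' + n')) (a ⊗ₜ[ℂ] f)) =
                piSchwartzBruhatEquiv (Fp L) (Fin (n' + n')) (a'' ⊗ₜ[ℂ] f)) →
          ∀ (T₁ : ↥(Submodule.span ℂ {x : piSchwartzBruhat (Fp L) (Fin (n' + n')) |
              ∃ a ∈ V, ∃ f : FinSB (Fp L) (Fin (n' + n')), x = piSchwartzBruhatEquiv (Fp L) (Fin (n' + n')) (a ⊗ₜ[ℂ] f)}) →ₗ[ℂ]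
              (HA L e dV hdV dW hdW → ℂ)),
            AdmissibleOn L e dV hdV hdV0 dW hdW hdW0 eW e' dV' hdV' hdV'0 χb hχbu hχbs α 𝒦 V T₁ →
            (∀ (V₀ : Submodule ℂ 𝓢(((Fin (n' + n')) → mixedSpace (Fp L)), ℂ)), FiniteDimensional ℂ V₀ →
              (∀ ainf : UnitaryGroup.arch (Fp L) L (IsCMField.complexConj L) (n + n) (hermD L e dV hdV dW hdW),
                (UnitaryGroup.archToAdelic (Fp L) L (IsCMField.complexConj L) (n + n) (hermD L e dV hdV dW hdW) ainf : HA L e dV hdV dW hdW) ∈ 𝒦.K →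
                ∀ a ∈ V₀, ∃ a'' ∈ V₀, ∀ f : FinSB (Fp L) (Fin (n' + n')),
                  adelicMpCont.omega (Fp L) (Fin (n' + n')) (gramDA L e' dV hdV (tensorFrame L dW eW dV') (tensorFrame_real L dW hdW eW dV' hdV'))
                      ((doubledWeilRep L e' dV hdV hdV0 (tensorFrame L dW eW dV') (tensorFrame_real L dW hdW eW dV' hdV')
                            (tensorFrame_ne_zero L dW eW dV' hdW0 hdV'0) χb hχbu hχbs)
                        (tensorEmb L e dV hdV dW hdW eW e' dV' hdV'
                          (UnitaryGroup.archToAdelic (Fp L) L (IsCMField.complexConj L) (n + n) (hermD L e dV hdV dW hdW) ainf)))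
                      (piSchwartzBruhatEquiv (Fp L) (Fin (n' + n')) (a ⊗ₜ[ℂ] f)) =
                    piSchwartzBruhatEquiv (Fp L) (Fin (n' + n')) (a'' ⊗ₜ[ℂ] f)) →
              HL L e dV hdV hdV0 dW hdW hdW0 lam hlam eW e' dV' hdV' hdV'0 χb hχbu hχbs α hα hαrat 𝒦 V₀ →
              ∀ (T₁₀ : ↥(Submodule.span ℂ {x : piSchwartzBruhat (Fp L) (Fin (n' + n')) |
                  ∃ a ∈ V₀, ∃ f : FinSB (Fp L) (Fin (n' + n')), x = piSchwartzBruhatEquiv (Fp L) (Fin (n' + n')) (a ⊗ₜ[ℂ] f)}) →ₗ[ℂ]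
                  (HA L e dV hdV dW hdW → ℂ)),
                AdmissibleOn L e dV hdV hdV0 dW hdW hdW0 eW e' dV' hdV' hdV'0 χb hχbu hχbs α 𝒦 V₀ T₁₀ → ThetaValuedOn L e dV hdV hdV0 dW hdW hdW0 lam hlam e₁ a' hρ μW fw V₀ T₁₀) →
            ThetaValuedOn L e dV hdV hdV0 dW hdW hdW0 lam hlam e₁ a' hρ μW fw V T₁)
    (hD₀ : ∀ (L : Type) [Field L] [NumberField L] [IsCMField L] {n : ℕ} (e : Fin 2 × Fin 1 ≃ Fin n)
      (dV : Fin 2 → L) (hdV : ∀ i, IsCMField.complexConj L (dV i) = dV i) (hdV0 : ∀ i, dV i ≠ 0)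
      (dW : Fin 1 → L) (hdW : ∀ i, IsCMField.complexConj L (dW i) = dW i) (hdW0 : ∀ i, dW i ≠ 0)
      (lam : Literature.NumberTheory.Automorphic.IdeleClassGroup L →ₜ* Circle) (hlam : IsConjugateSymplectic L lam),
      HasWeight L lam 1 →
      ∀ {M' n' : ℕ} (eW : Fin 1 × Fin 3 ≃ Fin M') (e' : Fin 2 × Fin M' ≃ Fin n')
        (dV' : Fin 3 → L) (hdV' : ∀ k, IsCMField.complexConj L (dV' k) = dV' k) (hdV'0 : ∀ k, dV' k ≠ 0)
        (χb : HeckeCharacter L) (hχbu : χb.IsUnitary) (hχbs : Literature.RepresentationTheory.HarrisKudlaSweet1996.IsSplittingChar L 1 χb)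
        (α : UnitaryGroup.adelicOne (Fp L) L (IsCMField.complexConj L) →* ℂˣ) (hα : Continuous α)
        (hαrat : ∀ u : UnitaryGroup.adelicOne (Fp L) L (IsCMField.complexConj L),
          (u : Literature.NumberTheory.GaloisRepresentations.ideleGroup L) ∈ Literature.NumberTheory.GaloisRepresentations.principalIdeles L → α u = 1)
        (_hχD : χb ^ 3 * DoubledWeilDetTwist.ratioHecke L α hα hαrat = toHeckeCharacter L lam⁻¹)
        (𝒦 : IwasawaDatum L e dV hdV dW hdW) (_h𝒦 : 𝒦.IsStd)
      {n'' : ℕ} (e₁ : Fin (n + n) × Fin 1 ≃ Fin n''),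
      -- FACE-D₀ (ED. 7): for an ISOTROPIC `V′` and every line of record `a′` (★ `exists_lineFrame`'s frame `T` and discriminant clause BY VALUE) …
      ∀ (a' : (↥(maximalRealSubfield L))ˣ) (T : GL (Fin 3) (AdeleRing (𝓞 L) L)),
        formCongr (conjAdele (Fp L) L (IsCMField.complexConj L)) T (adelicForm L 3 (Matrix.diagonal dV')) =
          adelicForm L (1 + 2) (finSum 1 2 (JW (Fp L) L a') !![0, 1; 1, 0]) →
        -((a' : Fp L) : L) ∈ (Set.range fun A : Matrix (Fin 3) (Fin 3) L =>
          (A.map (IsCMField.complexConj L : L →+* L)).det * (∏ k, dV' k) * A.det) →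
        -- … SOME theta datum `(hρ, μW, fw)` on `⟨a′⟩` — the PAYER's choice (the weight of record, pinned by row `h₁`; (w) EQUAL 2026-09-04) — with …
        ∃ (hρ : HasThetaMajorants fun
          (p : ↥(UnitaryGroup.adelic (↥(maximalRealSubfield L)) L (IsCMField.complexConj L) (n + n) (Matrix.diagonal (dD L e dV hdV dW hdW))) ×
            ↥(UnitaryGroup.adelic (↥(maximalRealSubfield L)) L (IsCMField.complexConj L) 1 (JW (↥(maximalRealSubfield L)) L a')))
          (Ψ : piSchwartzBruhat (↥(maximalRealSubfield L)) (Fin n'')) =>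
            pairRep (↥(maximalRealSubfield L)) L (IsCMField.complexConj L) (n + n) 1 e₁ (Matrix.diagonal (dD L e dV hdV dW hdW)) (JW (↥(maximalRealSubfield L)) L a')
              (chiSplittingLine L e₁ (dD L e dV hdV dW hdW) (dD_conj L e dV hdV dW hdW) (dD_ne_zero L e dV hdV dW hdW hdV0 hdW0)
                (toHeckeCharacter L lam⁻¹) (isUnitary_toHeckeCharacter L lam⁻¹)
                ((isOscillatorChar_toHeckeCharacter_iff lam⁻¹).mpr (K2LiuConjugateSymplecticInv.IsConjugateSymplectic.inv hlam)) (TW (↥(maximalRealSubfield L)) a')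
                (isUnit_det_TW (↥(maximalRealSubfield L)) a') (JW (↥(maximalRealSubfield L)) L a') (JW_eq (↥(maximalRealSubfield L)) L a'))
              p Ψ)
        (μW : @Measure (↥(UnitaryGroup.adelic (↥(maximalRealSubfield L)) L (IsCMField.complexConj L) 1 (JW (↥(maximalRealSubfield L)) L a')) ⧸
          (UnitaryGroup.toAdelic (↥(maximalRealSubfield L)) L (IsCMField.complexConj L) 1 (JW (↥(maximalRealSubfield L)) L a')).range) (borel _))
        (fw : C(↥(UnitaryGroup.adelic (↥(maximalRealSubfield L)) L (IsCMField.complexConj L) 1 (JW (↥(maximalRealSubfield L)) L a')) ⧸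
          (UnitaryGroup.toAdelic (↥(maximalRealSubfield L)) L (IsCMField.complexConj L) 1 (JW (↥(maximalRealSubfield L)) L a')).range, ℂ)),
        @IsFiniteMeasure _ (borel _) μW ∧
        @SMulInvariantMeasure
          ↥(UnitaryGroup.adelic (↥(maximalRealSubfield L)) L (IsCMField.complexConj L) 1 (JW (↥(maximalRealSubfield L)) L a'))
          (↥(UnitaryGroup.adelic (↥(maximalRealSubfield L)) L (IsCMField.complexConj L) 1 (JW (↥(maximalRealSubfield L)) L a')) ⧸
            (UnitaryGroup.toAdelic (↥(maximalRealSubfield L)) L (IsCMField.complexConj L) 1 (JW (↥(maximalRealSubfield L)) L a')).range)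
          _ (borel _) μW ∧
        -- … ★ U2's `hne`-free rows on every HOL-CUT rigidity domain (predicate `HL`) for every admissible `T₁`
        ∀ (V : Submodule ℂ 𝓢(((Fin (n' + n')) → mixedSpace (Fp L)), ℂ)), FiniteDimensional ℂ V →
          (∀ ainf : UnitaryGroup.arch (Fp L) L (IsCMField.complexConj L) (n + n) (hermD L e dV hdV dW hdW),
            (UnitaryGroup.archToAdelic (Fp L) L (IsCMField.complexConj L) (n + n) (hermD L e dV hdV dW hdW) ainf : HA L e dV hdV dW hdW) ∈ 𝒦.K →
            ∀ a ∈ V, ∃ a'' ∈ V, ∀ f : FinSB (Fp L) (Fin (n' + n')),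
              adelicMpCont.omega (Fp L) (Fin (n' + n')) (gramDA L e' dV hdV (tensorFrame L dW eW dV') (tensorFrame_real L dW hdW eW dV' hdV'))
                  ((doubledWeilRep L e' dV hdV hdV0 (tensorFrame L dW eW dV') (tensorFrame_real L dW hdW eW dV' hdV')
                        (tensorFrame_ne_zero L dW eW dV' hdW0 hdV'0) χb hχbu hχbs)
                    (tensorEmb L e dV hdV dW hdW eW e' dV' hdV'
                      (UnitaryGroup.archToAdelic (Fp L) L (IsCMField.complexConj L) (n + n) (hermD L e dV hdV dW hdW) ainf)))
                  (piSchwartzBruhatEquiv (Fp L) (Fin (n' + n')) (a ⊗ₜ[ℂ] f)) =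
                piSchwartzBruhatEquiv (Fp L) (Fin (n' + n')) (a'' ⊗ₜ[ℂ] f)) →
          HL L e dV hdV hdV0 dW hdW hdW0 lam hlam eW e' dV' hdV' hdV'0 χb hχbu hχbs α hα hαrat 𝒦 V →
          ∀ (T₁ : ↥(Submodule.span ℂ {x : piSchwartzBruhat (Fp L) (Fin (n' + n')) |
              ∃ a ∈ V, ∃ f : FinSB (Fp L) (Fin (n' + n')), x = piSchwartzBruhatEquiv (Fp L) (Fin (n' + n')) (a ⊗ₜ[ℂ] f)}) →ₗ[ℂ]
              (HA L e dV hdV dW hdW → ℂ)),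
            AdmissibleOn L e dV hdV hdV0 dW hdW hdW0 eW e' dV' hdV' hdV'0 χb hχbu hχbs α 𝒦 V T₁ → RigidityRowsOn L e dV hdV hdV0 dW hdW hdW0 lam hlam e₁ a' hρ μW fw V T₁) :
    -- ‹#42F′ :711–771 verbatim›
    ∀ (L : Type) [Field L] [NumberField L] [IsCMField L] {n : ℕ} (e : Fin 2 × Fin 1 ≃ Fin n)
      (dV : Fin 2 → L) (hdV : ∀ i, IsCMField.complexConj L (dV i) = dV i) (hdV0 : ∀ i, dV i ≠ 0)
      (dW : Fin 1 → L) (hdW : ∀ i, IsCMField.complexConj L (dW i) = dW i) (hdW0 : ∀ i, dW i ≠ 0)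
      (lam : Literature.NumberTheory.Automorphic.IdeleClassGroup L →ₜ* Circle) (hlam : IsConjugateSymplectic L lam),
      HasWeight L lam 1 →
      ∀ {M' n' : ℕ} (eW : Fin 1 × Fin 3 ≃ Fin M') (e' : Fin 2 × Fin M' ≃ Fin n')
        (dV' : Fin 3 → L) (hdV' : ∀ k, IsCMField.complexConj L (dV' k) = dV' k) (hdV'0 : ∀ k, dV' k ≠ 0)
        (χb : HeckeCharacter L) (hχbu : χb.IsUnitary) (hχbs : Literature.RepresentationTheory.HarrisKudlaSweet1996.IsSplittingChar L 1 χb)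
        (α : UnitaryGroup.adelicOne (Fp L) L (IsCMField.complexConj L) →* ℂˣ) (hα : Continuous α)
        (hαrat : ∀ u : UnitaryGroup.adelicOne (Fp L) L (IsCMField.complexConj L),
          (u : Literature.NumberTheory.GaloisRepresentations.ideleGroup L) ∈ Literature.NumberTheory.GaloisRepresentations.principalIdeles L → α u = 1)
        (_hχD : χb ^ 3 * DoubledWeilDetTwist.ratioHecke L α hα hαrat = toHeckeCharacter L lam⁻¹)
        (𝒦 : IwasawaDatum L e dV hdV dW hdW) (_h𝒦 : 𝒦.IsStd)
        (Φ : piSchwartzBruhat (Fp L) (Fin (n' + n')))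
        (_hΦ : FiniteDimensional ℂ (Submodule.span ℂ (Set.range fun k : 𝒦.K =>
          adelicMpCont.omega (Fp L) (Fin (n' + n')) (gramDA L e' dV hdV (tensorFrame L dW eW dV') (tensorFrame_real L dW hdW eW dV' hdV'))
            ((doubledWeilRep L e' dV hdV hdV0 (tensorFrame L dW eW dV') (tensorFrame_real L dW hdW eW dV' hdV')
                    (tensorFrame_ne_zero L dW eW dV' hdW0 hdV'0) χb hχbu hχbs)
              (tensorEmb L e dV hdV dW hdW eW e' dV' hdV' (k : HA L e dV hdV dW hdW))) Φ)))
        (Pg : Finset ℂ) (Eg : ℂ → HA L e dV hdV dW hdW → ℂ),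
        (∀ h : HA L e dV hdV dW hdW, DifferentiableOn ℂ (fun s => Eg s h) {s : ℂ | 0 < s.re}) →
        (∀ (s : ℂ) (h : HA L e dV hdV dW hdW), (n : ℝ) / 2 < s.re →
          Eg s h = (∏ p ∈ Pg, (s - p)) * eisensteinFamilyDelta L e dV hdV dW hdW
            (fun s₁ h₁ => ((DoubledWeilDetTwist.detChar L e dV hdV hdV0 dW hdW hdW0 α h₁ : ℂˣ) : ℂ) *
              stdExtension 𝒦 ((((3 : ℕ) : ℂ) - (n : ℂ)) / 2)
                (swSectionTensor L e dV hdV dW hdW eW e' dV' hdV' hdV0 hdW0 hdV'0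
                  (doubledWeilRep L e' dV hdV hdV0 (tensorFrame L dW eW dV') (tensorFrame_real L dW hdW eW dV' hdV')
                    (tensorFrame_ne_zero L dW eW dV' hdW0 hdV'0) χb hχbu hχbs) Φ) s₁ h₁) s h) →
      ∀ {n'' : ℕ} (e₁ : Fin (n + n) × Fin 1 ≃ Fin n''),
      ∃ (a' : (↥(maximalRealSubfield L))ˣ) (κ : ℂ) (_hκ : κ ≠ 0) (Φ' : piSchwartzBruhat (↥(maximalRealSubfield L)) (Fin n''))
        (hρ : HasThetaMajorants fun
          (p : ↥(UnitaryGroup.adelic (↥(maximalRealSubfield L)) L (IsCMField.complexConj L) (n + n) (Matrix.diagonal (dD L e dV hdV dW hdW))) ×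
            ↥(UnitaryGroup.adelic (↥(maximalRealSubfield L)) L (IsCMField.complexConj L) 1 (JW (↥(maximalRealSubfield L)) L a')))
          (Ψ : piSchwartzBruhat (↥(maximalRealSubfield L)) (Fin n'')) =>
            pairRep (↥(maximalRealSubfield L)) L (IsCMField.complexConj L) (n + n) 1 e₁ (Matrix.diagonal (dD L e dV hdV dW hdW)) (JW (↥(maximalRealSubfield L)) L a')
              (chiSplittingLine L e₁ (dD L e dV hdV dW hdW) (dD_conj L e dV hdV dW hdW) (dD_ne_zero L e dV hdV dW hdW hdV0 hdW0)
                (toHeckeCharacter L lam⁻¹) (isUnitary_toHeckeCharacter L lam⁻¹)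
                ((isOscillatorChar_toHeckeCharacter_iff lam⁻¹).mpr (K2LiuConjugateSymplecticInv.IsConjugateSymplectic.inv hlam)) (TW (↥(maximalRealSubfield L)) a')
                (isUnit_det_TW (↥(maximalRealSubfield L)) a') (JW (↥(maximalRealSubfield L)) L a') (JW_eq (↥(maximalRealSubfield L)) L a'))
              p Ψ)
        (μW : @Measure (↥(UnitaryGroup.adelic (↥(maximalRealSubfield L)) L (IsCMField.complexConj L) 1 (JW (↥(maximalRealSubfield L)) L a')) ⧸
          (UnitaryGroup.toAdelic (↥(maximalRealSubfield L)) L (IsCMField.complexConj L) 1 (JW (↥(maximalRealSubfield L)) L a')).range) (borel _))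
        (fw : C(↥(UnitaryGroup.adelic (↥(maximalRealSubfield L)) L (IsCMField.complexConj L) 1 (JW (↥(maximalRealSubfield L)) L a')) ⧸
          (UnitaryGroup.toAdelic (↥(maximalRealSubfield L)) L (IsCMField.complexConj L) 1 (JW (↥(maximalRealSubfield L)) L a')).range, ℂ)),
        @IsFiniteMeasure _ (borel _) μW ∧
        @SMulInvariantMeasure
          ↥(UnitaryGroup.adelic (↥(maximalRealSubfield L)) L (IsCMField.complexConj L) 1 (JW (↥(maximalRealSubfield L)) L a'))
          (↥(UnitaryGroup.adelic (↥(maximalRealSubfield L)) L (IsCMField.complexConj L) 1 (JW (↥(maximalRealSubfield L)) L a')) ⧸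
            (UnitaryGroup.toAdelic (↥(maximalRealSubfield L)) L (IsCMField.complexConj L) 1 (JW (↥(maximalRealSubfield L)) L a')).range)
          _ (borel _) μW ∧
        ∀ h : HA L e dV hdV dW hdW,
          Tendsto (fun s : ℂ => (s - 1 / 2) * (Eg s h / ∏ p ∈ Pg, (s - p))) (𝓝[≠] (1 / 2))
            (𝓝 (κ * @doubledLineThetaLift L _ _ _ 2 1 n e dV hdV dW hdW n'' e₁ hdV0 hdW0 lam⁻¹ (K2LiuConjugateSymplecticInv.IsConjugateSymplectic.inv hlam) a' hρ
              (borel _) μW Φ' fw h)) := by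
  refine firstTermIdentityOnGenerators_of_rigidityFace h41 ?_
  -- ‹FACE-R› from FACE-A ∕ FACE-G ∕ FACE-D₀ by cases on the isotropy of `V′`
  intro L _ _ _ n e dV hdV hdV0 dW hdW hdW0 lam hlam hwt M' n' eW e' dV' hdV' hdV'0 χb hχbu hχbs α hα hαrat hχD 𝒦 h𝒦 n'' e₁
  by_cases hiso : ∃ v : Fin 3 → L, v ≠ 0 ∧ ∑ k, dV' k * (v k * IsCMField.complexConj L (v k)) = 0
  · -- ISOTROPIC `V′`: the line of record, the payer's datum (FACE-D₀), then the (R-gen) reduction (FACE-G) fed by ★ U2 on the hol cut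
    obtain ⟨a', T, hT, hdisc⟩ := exists_lineFrame L dV' hdV' hdV'0 hiso
    obtain ⟨hρ, μW, fw, hfin, hinv, hrows⟩ :=
      hD₀ L e dV hdV hdV0 dW hdW hdW0 lam hlam hwt eW e' dV' hdV' hdV'0 χb hχbu hχbs α hα hαrat hχD 𝒦 h𝒦 e₁ a' T hT hdisc
    refine ⟨a', hρ, μW, fw, hfin, hinv, ?_⟩
    intro V hVfd harch T₁ hTa hTb hTc hTγ hTg
    have hadm : AdmissibleOn L e dV hdV hdV0 dW hdW hdW0 eW e' dV' hdV' hdV'0 χb hχbu hχbs α 𝒦 V T₁ := by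
      unfold AdmissibleOn
      exact ⟨hTa, hTb, hTc, hTγ, hTg⟩
    have hθ : ThetaValuedOn L e dV hdV hdV0 dW hdW hdW0 lam hlam e₁ a' hρ μW fw V T₁ := by
      refine hG L e dV hdV hdV0 dW hdW hdW0 lam hlam hwt eW e' dV' hdV' hdV'0 χb hχbu hχbs α hα hαrat hχD 𝒦 h𝒦 e₁ a' T hT hdisc
        hρ μW fw hfin hinv V hVfd harch T₁ hadm ?_
      -- FACE-G's hol-cut hypothesis: on `HL`-domains every admissible residue map is `B_{fw}`-valued (FACE-D₀'s rows + ★ U2 without `hne`)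
      intro V₀ hV₀fd harch₀ hHL T₁₀ hadm₀
      have hr := hrows V₀ hV₀fd harch₀ hHL T₁₀ hadm₀
      unfold RigidityRowsOn at hr
      obtain ⟨𝓣, T₂, hT₂B, P, hP₁, hP₂, coeff, R, S, hdet, hT₁', hT₂', h2₁, h2₂, hfin₁, hfin₂, c₁, h₁⟩ := hr
      obtain ⟨c, hc⟩ := rankOneRigidity_of_eq_smul_split
        (D := ↥(Submodule.span ℂ {x : piSchwartzBruhat (Fp L) (Fin (n' + n')) |
          ∃ a ∈ V₀, ∃ f : FinSB (Fp L) (Fin (n' + n')), x = piSchwartzBruhatEquiv (Fp L) (Fin (n' + n')) (a ⊗ₜ[ℂ] f)}))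
        (M := HA L e dV hdV dW hdW → ℂ) (N := ↥P) L (LinearMap.codRestrict P T₁₀ hP₁) (LinearMap.codRestrict P T₂ hP₂) coeff a' R S ⊤
        (fun _ => Submodule.mem_top) (fun _ => Submodule.mem_top) (fun y _ hy => hdet y hy) hT₁' hT₂' h2₁ h2₂ hfin₁ hfin₂ h₁
      unfold ThetaValuedOn
      intro x₀
      have hcx : T₁₀ x₀ = c • T₂ x₀ := by
        have h := congrArg Subtype.val (hc x₀)
        simpa only [LinearMap.codRestrict_apply, Submodule.coe_smul] using h
      letI : MeasurableSpace (↥(UnitaryGroup.adelic (Fp L) L (IsCMField.complexConj L) 1 (JW (Fp L) L a')) ⧸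
          (UnitaryGroup.toAdelic (Fp L) L (IsCMField.complexConj L) 1 (JW (Fp L) L a')).range) := borel _
      refine ⟨c • 𝓣 x₀, fun h => ?_⟩
      rw [doubledLineThetaLift_smul, ← hT₂B x₀ h, hcx, Pi.smul_apply, smul_eq_mul]
    unfold ThetaValuedOn at hθ
    exact hθ
  · -- ANISOTROPIC `V′`: the residue map vanishes (FACE-A); `a′ := 1`, the theta datum of record on `⟨1⟩`, `Φ′ := 0`
    letI : MeasurableSpace (↥(UnitaryGroup.adelic (Fp L) L (IsCMField.complexConj L) 1 (JW (Fp L) L 1)) ⧸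
        (UnitaryGroup.toAdelic (Fp L) L (IsCMField.complexConj L) 1 (JW (Fp L) L 1)).range) := borel _
    obtain ⟨hρ, μW, χ, fw, Φ₀, hfin, hinv, -, -, -, -, -, -⟩ :=
      exists_lineThetaSide_witness L e dV hdV hdV0 dW hdW hdW0 lam⁻¹ (K2LiuConjugateSymplecticInv.IsConjugateSymplectic.inv hlam) 1 e₁
    refine ⟨1, hρ, μW, fw, hfin, hinv, ?_⟩
    intro V hVfd harch T₁ hTa hTb hTc hTγ hTg x
    have hadm : AdmissibleOn L e dV hdV hdV0 dW hdW hdW0 eW e' dV' hdV' hdV'0 χb hχbu hχbs α 𝒦 V T₁ := by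
      unfold AdmissibleOn
      exact ⟨hTa, hTb, hTc, hTγ, hTg⟩
    have hx : T₁ x = 0 :=
      hA L e dV hdV hdV0 dW hdW hdW0 lam hlam hwt eW e' dV' hdV' hdV'0 χb hχbu hχbs α hα hαrat hχD 𝒦 h𝒦 hiso V hVfd harch T₁ hadm x
    refine ⟨0, fun h => ?_⟩
    rw [hx, Pi.zero_apply, ← zero_smul ℂ (0 : piSchwartzBruhat (Fp L) (Fin n'')), doubledLineThetaLift_smul, zero_mul]

end Summit.HodgeConjecture.HodgeConjecture.Cruxes.HLiu418.K2LiuFirstTermIdentityAssemblyHolCut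

end
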